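import Mathlib
import Summits.NavierStokesRegularity.NavierStokesRegularity.Theorems.DssFarFieldSlavingBlowupTypeIDssProfileSimilarityEnstrophyIBP
import Summits.NavierStokesRegularity.NavierStokesRegularity.Theorems.DssFarFieldSlavingBlowupTypeIDssProfileSimilarityEnstrophyIntegrability
import HarnessLib

/-!
# Similarity enstrophy, file 4/4: the identity `½Z' = −∫|∇Ω|²_F − ¼Z + ∫⟪Ω,(∇U)Ω⟫` under (D)
  (pub-ns-dss theory T38-SCOPE (S1); route `DssFarFieldSlaving`, crux `BlowupTypeIDssProfile`,
  stmt-NavierStokesRegularity-0155 — SUPPORT, label-free helper; typer seat g6, 2026-08-23)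

HONEST FRAMING. Label-free analysis helper for the T38-SCOPE plan of the cell's theory seat (S3 → S2 → S1 → S4;
LIOUVILLE-SIDE l.177): an IDENTITY / estimates for a HYPOTHETICAL object (the similarity vorticity of a Type-I ancient mild
field) under the NAMED space–time decay hypothesis (D), which is NOT derived from Type-I membership here. No census words
change (the explicit rows T31″ / T34 / T38 stay DERIVED until S4 lands); nothing numeric; nothing here bears on Navier–Stokes
regularity or blow-up. Idea credit for the Hardy-weighted stretching threshold: the OPEN item
`StretchingWellBinding.DssProfileBinding` (stmt-1578), not addressed here.

CONTENTS. `norm_vorticityRHS_le_decay` (`‖∂ₛΩ‖ ≲ (1+|y|)^{−2}` uniformly in `s`),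
`hasDerivAt_integral_norm_lerayVorticity_sq` (dominated differentiation of
`Z(s) = ∫|Ω(s)|²`, domination uniform in `s`), and the assembled **`similarityEnstrophy_hasDerivAt`**:
`Z'(s) = 2(−∫|∇Ω(s)|²_F − ¼Z(s) + ∫⟪Ω(s), DU(s)Ω(s)⟫)` for a KNSS-gauge Type-I field under (D) at
`k = 1, 2, 3` — the unweighted twin of the tree's Gaussian-weighted `GaussianGap.gaussianEnstrophy_hasDerivAt`,
from the similarity vorticity equation paired with `Ω` and the three integrations by parts of file 1
(`∫⟪ΔΩ,Ω⟫ = −∫|∇Ω|²_F`, `∫⟪(y·∇)Ω,Ω⟫ = −(3/2)Z`, `∫⟪(U·∇)Ω,Ω⟫ = 0`). Consumers: the conditional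
explicit rows T31″ / T34 / T38 (S4, not typed here). [this file; theory T38-SCOPE (S1)]
-/

noncomputable section

set_option linter.dupNamespace false

namespace Summit.NavierStokesRegularity.NavierStokesRegularity.Theorems.SimilarityEnstrophy

open MeasureTheory Set Filter Topology Module Metric InnerProductSpace Function
open scoped RealInnerProductSpace Laplacian ContDiff
open Literature.Analysis Literature.Analysis.FluidPDE
open Summit.NavierStokesRegularity.NavierStokesRegularity.Theorems.GaussianGap
open Summit.NavierStokesRegularity.NavierStokesRegularity.Theorems.PlanarEnergyAPriori

variable {M : ℝ} {V : ℝ → EuclideanSpace ℝ (Fin 3) → EuclideanSpace ℝ (Fin 3)}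

/-- Pointwise bound for the right-hand side `R = ΔΩ − Ω − ½DΩ(y) − DΩ(U) + DU(Ω)` of the
similarity vorticity equation under (D): `‖R(s,y)‖ ≤ K (1 + ‖y‖)^{−2}`, uniformly in `s`. [folklore] -/
theorem norm_vorticityRHS_le_decay (hV : IsTypeIAncientMild M V) {C₁ C₂ C₃ : ℝ}
    (hD1 : ∀ t < 0, ∀ x, (‖x‖ + Real.sqrt (-t)) ^ (1 + 1) * ‖iteratedFDeriv ℝ 1 (V t) x‖ ≤ C₁)
    (hD2 : ∀ t < 0, ∀ x, (‖x‖ + Real.sqrt (-t)) ^ (2 + 1) * ‖iteratedFDeriv ℝ 2 (V t) x‖ ≤ C₂)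
    (hD3 : ∀ t < 0, ∀ x, (‖x‖ + Real.sqrt (-t)) ^ (3 + 1) * ‖iteratedFDeriv ℝ 3 (V t) x‖ ≤ C₃)
    (s : ℝ) (y : EuclideanSpace ℝ (Fin 3)) :
    ‖(Δ (lerayVorticity V s)) y - lerayVorticity V s y
        - (1 / 2 : ℝ) • fderiv ℝ (lerayVorticity V s) y y
        - fderiv ℝ (lerayVorticity V s) y (lerayOrbit V s y)
        + fderiv ℝ (lerayOrbit V s) y (lerayVorticity V s y)‖ ≤
      (3 * (‖curlCLM‖ * C₃) + ‖curlCLM‖ * C₁ + (1 / 2) * (‖curlCLM‖ * C₂) + ‖curlCLM‖ * C₂ * M +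
        C₁ * (‖curlCLM‖ * C₁)) * (1 + ‖y‖) ^ (-(2 : ℝ)) := by
  have hC₁ := decayConst_nonneg hD1
  have hC₂ := decayConst_nonneg hD2
  have hC₃ := decayConst_nonneg hD3
  have hM : 0 ≤ M := hV.nonneg
  have hc : 0 ≤ ‖curlCLM‖ := norm_nonneg curlCLM
  have d2 : 0 ≤ (1 + ‖y‖) ^ (-(2 : ℝ)) := Real.rpow_nonneg (by positivity) _
  -- the five terms
  have t1 : ‖(Δ (lerayVorticity V s)) y‖ ≤ 3 * (‖curlCLM‖ * C₃) * (1 + ‖y‖) ^ (-(2 : ℝ)) :=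
    (norm_laplacian_lerayVorticity_le_decay hV hD3 s y).trans
      (mul_le_mul_of_nonneg_left (SlabLaw.rpow_neg_le_rpow_neg_of_le y (by norm_num)) (by positivity))
  have t2 : ‖lerayVorticity V s y‖ ≤ ‖curlCLM‖ * C₁ * (1 + ‖y‖) ^ (-(2 : ℝ)) :=
    norm_lerayVorticity_le_decay hV hD1 s y
  have t3 : ‖(1 / 2 : ℝ) • fderiv ℝ (lerayVorticity V s) y y‖ ≤
      (1 / 2) * (‖curlCLM‖ * C₂) * (1 + ‖y‖) ^ (-(2 : ℝ)) := by
    rw [norm_smul, Real.norm_of_nonneg (by norm_num : (0:ℝ) ≤ 1 / 2), mul_assoc]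
    refine mul_le_mul_of_nonneg_left ?_ (by norm_num)
    calc ‖fderiv ℝ (lerayVorticity V s) y y‖ ≤ ‖fderiv ℝ (lerayVorticity V s) y‖ * ‖y‖ :=
          ContinuousLinearMap.le_opNorm _ _
      _ ≤ ‖curlCLM‖ * C₂ * (1 + ‖y‖) ^ (-(3 : ℝ)) * ‖y‖ :=
          mul_le_mul_of_nonneg_right (norm_fderiv_lerayVorticity_le_decay hV hD2 s y) (norm_nonneg _)
      _ = ‖curlCLM‖ * C₂ * (‖y‖ * (1 + ‖y‖) ^ (-(3 : ℝ))) := by ring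
      _ ≤ ‖curlCLM‖ * C₂ * (1 + ‖y‖) ^ (-((3 : ℝ) - 1)) :=
          mul_le_mul_of_nonneg_left (norm_mul_decay_le y 3) (by positivity)
      _ = ‖curlCLM‖ * C₂ * (1 + ‖y‖) ^ (-(2 : ℝ)) := by norm_num
  have t4 : ‖fderiv ℝ (lerayVorticity V s) y (lerayOrbit V s y)‖ ≤
      ‖curlCLM‖ * C₂ * M * (1 + ‖y‖) ^ (-(2 : ℝ)) := by
    calc ‖fderiv ℝ (lerayVorticity V s) y (lerayOrbit V s y)‖
        ≤ ‖fderiv ℝ (lerayVorticity V s) y‖ * ‖lerayOrbit V s y‖ := ContinuousLinearMap.le_opNorm _ _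
      _ ≤ ‖curlCLM‖ * C₂ * (1 + ‖y‖) ^ (-(3 : ℝ)) * M :=
          mul_le_mul (norm_fderiv_lerayVorticity_le_decay hV hD2 s y) (norm_lerayOrbit_le_of_typeI hV s y)
            (norm_nonneg _) (by positivity)
      _ = ‖curlCLM‖ * C₂ * M * (1 + ‖y‖) ^ (-(3 : ℝ)) := by ring
      _ ≤ ‖curlCLM‖ * C₂ * M * (1 + ‖y‖) ^ (-(2 : ℝ)) :=
          mul_le_mul_of_nonneg_left (SlabLaw.rpow_neg_le_rpow_neg_of_le y (by norm_num)) (by positivity)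
  have t5 : ‖fderiv ℝ (lerayOrbit V s) y (lerayVorticity V s y)‖ ≤
      C₁ * (‖curlCLM‖ * C₁) * (1 + ‖y‖) ^ (-(2 : ℝ)) := by
    calc ‖fderiv ℝ (lerayOrbit V s) y (lerayVorticity V s y)‖
        ≤ ‖fderiv ℝ (lerayOrbit V s) y‖ * ‖lerayVorticity V s y‖ := ContinuousLinearMap.le_opNorm _ _
      _ ≤ C₁ * (1 + ‖y‖) ^ (-(2 : ℝ)) * (‖curlCLM‖ * C₁ * (1 + ‖y‖) ^ (-(2 : ℝ))) :=
          mul_le_mul (norm_fderiv_lerayOrbit_le_decay hV hD1 s y) t2 (norm_nonneg _) (by positivity)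
      _ = C₁ * (‖curlCLM‖ * C₁) * (1 + ‖y‖) ^ (-((2 : ℝ) + 2)) := by rw [← SlabLaw.rpow_neg_mul_rpow_neg]; ring
      _ ≤ C₁ * (‖curlCLM‖ * C₁) * (1 + ‖y‖) ^ (-(2 : ℝ)) :=
          mul_le_mul_of_nonneg_left (SlabLaw.rpow_neg_le_rpow_neg_of_le y (by norm_num)) (by positivity)
  -- triangle inequality
  set a := (Δ (lerayVorticity V s)) y
  set b := lerayVorticity V s y
  set c := (1 / 2 : ℝ) • fderiv ℝ (lerayVorticity V s) y y
  set d := fderiv ℝ (lerayVorticity V s) y (lerayOrbit V s y)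
  set e := fderiv ℝ (lerayOrbit V s) y (lerayVorticity V s y)
  have n1 : ‖a - b‖ ≤ ‖a‖ + ‖b‖ := norm_sub_le _ _
  have n2 : ‖a - b - c‖ ≤ ‖a - b‖ + ‖c‖ := norm_sub_le _ _
  have n3 : ‖a - b - c - d‖ ≤ ‖a - b - c‖ + ‖d‖ := norm_sub_le _ _
  have n4 : ‖a - b - c - d + e‖ ≤ ‖a - b - c - d‖ + ‖e‖ := norm_add_le _ _
  set w : ℝ := (1 + ‖y‖) ^ (-(2 : ℝ))
  nlinarith [n1, n2, n3, n4, t1, t2, t3, t4, t5, d2]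

/-- **The similarity enstrophy is differentiable, with derivative `2∫⟪Ω, ∂ₛΩ⟫`** (dominated
differentiation under the integral; the domination `‖2⟪Ω, R⟫‖ ≤ K(1 + ‖y‖)^{−4}` is uniform in `s`
under (D)). [folklore] -/
theorem hasDerivAt_integral_norm_lerayVorticity_sq (hV : IsTypeIAncientMild M V) {C₁ C₂ C₃ : ℝ}
    (hD1 : ∀ t < 0, ∀ x, (‖x‖ + Real.sqrt (-t)) ^ (1 + 1) * ‖iteratedFDeriv ℝ 1 (V t) x‖ ≤ C₁)
    (hD2 : ∀ t < 0, ∀ x, (‖x‖ + Real.sqrt (-t)) ^ (2 + 1) * ‖iteratedFDeriv ℝ 2 (V t) x‖ ≤ C₂)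
    (hD3 : ∀ t < 0, ∀ x, (‖x‖ + Real.sqrt (-t)) ^ (3 + 1) * ‖iteratedFDeriv ℝ 3 (V t) x‖ ≤ C₃)
    (s : ℝ) :
    HasDerivAt (fun σ => ∫ y, ‖lerayVorticity V σ y‖ ^ 2)
      (∫ y, 2 * ⟪lerayVorticity V s y,
        (Δ (lerayVorticity V s)) y - lerayVorticity V s y
          - (1 / 2 : ℝ) • fderiv ℝ (lerayVorticity V s) y y
          - fderiv ℝ (lerayVorticity V s) y (lerayOrbit V s y)
          + fderiv ℝ (lerayOrbit V s) y (lerayVorticity V s y)⟫) s := by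
  set K : ℝ := 3 * (‖curlCLM‖ * C₃) + ‖curlCLM‖ * C₁ + (1 / 2) * (‖curlCLM‖ * C₂) +
    ‖curlCLM‖ * C₂ * M + C₁ * (‖curlCLM‖ * C₁) with hK
  have hΩ := fun σ => contDiff_lerayVorticity_slice hV σ
  have hU := fun σ => contDiff_lerayOrbit_slice_of_typeI hV σ (n := 1) (by norm_cast)
  have cR : ∀ σ, Continuous fun y => (Δ (lerayVorticity V σ)) y - lerayVorticity V σ y
      - (1 / 2 : ℝ) • fderiv ℝ (lerayVorticity V σ) y y - fderiv ℝ (lerayVorticity V σ) y (lerayOrbit V σ y)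
      + fderiv ℝ (lerayOrbit V σ) y (lerayVorticity V σ y) := by
    intro σ
    have c1 : Continuous (Δ (lerayVorticity V σ)) := continuous_laplacian ((hΩ σ).of_le (by norm_cast))
    have c2 : Continuous (fderiv ℝ (lerayVorticity V σ)) := (hΩ σ).continuous_fderiv (by simp)
    have c3 : Continuous (fderiv ℝ (lerayOrbit V σ)) := (hU σ).continuous_fderiv one_ne_zero
    have c4 : Continuous (lerayOrbit V σ) := (hU σ).continuous
    have c0 : Continuous (lerayVorticity V σ) := (hΩ σ).continuous
    have c5 : Continuous fun y => fderiv ℝ (lerayVorticity V σ) y y := c2.clm_apply continuous_id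
    have c6 : Continuous fun y => fderiv ℝ (lerayVorticity V σ) y (lerayOrbit V σ y) := c2.clm_apply c4
    have c7 : Continuous fun y => fderiv ℝ (lerayOrbit V σ) y (lerayVorticity V σ y) := c3.clm_apply c0
    have c8 : Continuous fun y => (1 / 2 : ℝ) • fderiv ℝ (lerayVorticity V σ) y y :=
      c5.const_smul (1 / 2 : ℝ)
    exact (((c1.sub c0).sub c8).sub c6).add c7
  have h := hasDerivAt_integral_of_dominated_loc_of_deriv_le (μ := volume) (s := univ)
    (F := fun σ y => ‖lerayVorticity V σ y‖ ^ 2)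
    (F' := fun σ y => 2 * ⟪lerayVorticity V σ y,
      (Δ (lerayVorticity V σ)) y - lerayVorticity V σ y
        - (1 / 2 : ℝ) • fderiv ℝ (lerayVorticity V σ) y y
        - fderiv ℝ (lerayVorticity V σ) y (lerayOrbit V σ y)
        + fderiv ℝ (lerayOrbit V σ) y (lerayVorticity V σ y)⟫)
    (bound := fun y => 2 * ((‖curlCLM‖ * C₁) * K) * (1 + ‖y‖) ^ (-(4 : ℝ))) (x₀ := s) univ_mem
    ?_ ?_ ?_ ?_ ?_ ?_
  · exact h.2
  · exact Eventually.of_forall fun σ => ((hΩ σ).continuous.norm.pow 2).aestronglyMeasurable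
  · exact integrable_norm_lerayVorticity_sq hV hD1 s
  · exact (continuous_const.mul ((hΩ s).continuous.inner (cR s))).aestronglyMeasurable
  · refine Eventually.of_forall fun y σ _ => ?_
    have hR := norm_vorticityRHS_le_decay hV hD1 hD2 hD3 σ y
    have hΩb := norm_lerayVorticity_le_decay hV hD1 σ y
    have hΩ0 : 0 ≤ ‖curlCLM‖ * C₁ * (1 + ‖y‖) ^ (-(2 : ℝ)) := (norm_nonneg _).trans hΩb
    rw [norm_mul, Real.norm_of_nonneg (by norm_num : (0:ℝ) ≤ 2), mul_assoc, mul_assoc]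
    refine mul_le_mul_of_nonneg_left ?_ (by norm_num)
    calc ‖⟪lerayVorticity V σ y, _⟫‖ ≤ ‖lerayVorticity V σ y‖ * ‖_‖ := norm_inner_le_norm _ _
      _ ≤ (‖curlCLM‖ * C₁ * (1 + ‖y‖) ^ (-(2 : ℝ))) * (K * (1 + ‖y‖) ^ (-(2 : ℝ))) :=
          mul_le_mul hΩb hR (norm_nonneg _) hΩ0
      _ = ‖curlCLM‖ * C₁ * (K * (1 + ‖y‖) ^ (-(4 : ℝ))) := by
          rw [show (-(4 : ℝ)) = -((2 : ℝ) + 2) by norm_num, ← SlabLaw.rpow_neg_mul_rpow_neg]; ring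
  · have hcont : Continuous fun y : EuclideanSpace ℝ (Fin 3) =>
        2 * ((‖curlCLM‖ * C₁) * K) * (1 + ‖y‖) ^ (-(4 : ℝ)) :=
      continuous_const.mul ((continuous_const.add continuous_norm).rpow_const
        fun y => Or.inl (add_pos_of_pos_of_nonneg one_pos (norm_nonneg y)).ne')
    exact integrable_of_le_decay_four hcont (K := 2 * ((‖curlCLM‖ * C₁) * K)) fun y => by
      rw [Real.norm_of_nonneg]
      have hC₁ := decayConst_nonneg hD1
      have hC₂ := decayConst_nonneg hD2
      have hC₃ := decayConst_nonneg hD3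
      have hM : 0 ≤ M := hV.nonneg
      positivity
  · exact Eventually.of_forall fun y σ _ => (lerayVorticity_hasDerivAt hV σ y).norm_sq

/-- **T38-SCOPE (S1): the similarity-enstrophy identity.** For a Type-I ancient mild field `V` in
the KNSS gauge (`IsTypeIAncientMild M V`) satisfying the space–time decay hypothesis (D) at orders
`k = 1, 2, 3` (`(‖x‖ + √(−t))^{k+1} ‖DᵏV(t)(x)‖ ≤ C_k`), the similarity enstrophy
`Z(s) = ∫ ‖Ω(s,y)‖² dy` of `Ω = lerayVorticity V` (`= curl (lerayOrbit V s)`) is differentiable on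
`ℝ` with
`Z'(s) = 2 ( −∫ |∇Ω(s)|²_F − ¼ Z(s) + ∫ ⟪Ω(s), DU(s) Ω(s)⟫ )`, `U = lerayOrbit V`,
i.e. `½Z' = −∫|∇Ω|²_F − ¼Z + ∫⟪Ω,(∇U)Ω⟫`: pair the similarity vorticity equation
`∂ₛΩ = ΔΩ − Ω − ½(y·∇)Ω − (U·∇)Ω + (Ω·∇)U` (`IsTypeIAncientMild.lerayVorticity_eq`) with `Ω`;
`∫⟪ΔΩ,Ω⟫ = −∫|∇Ω|²_F`, `∫⟪(y·∇)Ω,Ω⟫ = −(3/2)Z`, `∫⟪(U·∇)Ω,Ω⟫ = 0` (whole-space integrations by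
parts under integrability only — the drift flux `|y||Ω|² ∼ |y|^{−3}` is not integrable), and
`d/ds` under `∫` by dominated convergence, all dominations being uniform in `s` under (D). The decay
(D) is a NAMED hypothesis (not derived from Type-I membership here). Consumers: the conditional
explicit rows T31″ / T34 / T38 of the cell's theory seat (S4). [this file; theory T38-SCOPE (S1),
LIOUVILLE-SIDE l.177; binders per theory (α) 2026-08-23T08:17:56Z] -/
theorem similarityEnstrophy_hasDerivAt (hV : IsTypeIAncientMild M V) {C₁ C₂ C₃ : ℝ}
    (hD1 : ∀ t < 0, ∀ x, (‖x‖ + Real.sqrt (-t)) ^ (1 + 1) * ‖iteratedFDeriv ℝ 1 (V t) x‖ ≤ C₁)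
    (hD2 : ∀ t < 0, ∀ x, (‖x‖ + Real.sqrt (-t)) ^ (2 + 1) * ‖iteratedFDeriv ℝ 2 (V t) x‖ ≤ C₂)
    (hD3 : ∀ t < 0, ∀ x, (‖x‖ + Real.sqrt (-t)) ^ (3 + 1) * ‖iteratedFDeriv ℝ 3 (V t) x‖ ≤ C₃)
    (s : ℝ) :
    HasDerivAt (fun σ => ∫ y, ‖lerayVorticity V σ y‖ ^ 2)
      (2 * (-(∫ y, frobeniusNormSq (fderiv ℝ (lerayVorticity V s) y))
        - (1 / 4) * (∫ y, ‖lerayVorticity V s y‖ ^ 2)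
        + ∫ y, ⟪lerayVorticity V s y, fderiv ℝ (lerayOrbit V s) y (lerayVorticity V s y)⟫)) s := by
  refine (hasDerivAt_integral_norm_lerayVorticity_sq hV hD1 hD2 hD3 s).congr_deriv ?_
  -- integrability of the five pairings
  have iZ := integrable_norm_lerayVorticity_sq hV hD1 s
  have iF := integrable_frobeniusNormSq_fderiv_lerayVorticity hV hD2 s
  have iL := integrable_inner_laplacian_lerayVorticity hV hD1 hD3 s
  have iD := integrable_inner_fderiv_self_lerayVorticity hV hD1 hD2 s
  have iT := integrable_inner_convect_lerayVorticity hV hD1 hD2 s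
  have iS := integrable_inner_stretching_lerayVorticity hV hD1 s
  -- the three integrations by parts
  have hΩ := contDiff_lerayVorticity_slice hV s
  have hU : ContDiff ℝ ∞ (lerayOrbit V s) := contDiff_lerayOrbit_slice_of_typeI hV s le_rfl
  have hdiv : VectorCalculus.IsDivFree (lerayOrbit V s) :=
    (isDivFree_lerayOrbit_iff V s).2 (hV.isDivFree (neg_neg_of_pos (Real.exp_pos _)))
  have hL := integral_inner_laplacian_self_eq_neg_integral_frobeniusNormSq hΩ iZ iF iL
  have hR := two_mul_integral_inner_fderiv_self_self_eq hΩ iZ iD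
  rw [finrank_euclideanSpace_fin] at hR
  simp only [Nat.cast_ofNat] at hR
  have hT := integral_inner_convect_self_eq_zero hΩ hU hdiv (fun y => norm_lerayOrbit_le_of_typeI hV s y) iZ iT
  -- pointwise expansion of the pairing
  have hpt : ∀ y, 2 * ⟪lerayVorticity V s y,
      (Δ (lerayVorticity V s)) y - lerayVorticity V s y
        - (1 / 2 : ℝ) • fderiv ℝ (lerayVorticity V s) y y
        - fderiv ℝ (lerayVorticity V s) y (lerayOrbit V s y)
        + fderiv ℝ (lerayOrbit V s) y (lerayVorticity V s y)⟫ =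
      2 * ⟪(Δ (lerayVorticity V s)) y, lerayVorticity V s y⟫ - 2 * ‖lerayVorticity V s y‖ ^ 2
        - ⟪fderiv ℝ (lerayVorticity V s) y y, lerayVorticity V s y⟫
        - 2 * ⟪convect (lerayOrbit V s) (lerayVorticity V s) y, lerayVorticity V s y⟫
        + 2 * ⟪lerayVorticity V s y, fderiv ℝ (lerayOrbit V s) y (lerayVorticity V s y)⟫ := by
    intro y
    have e1 : ⟪lerayVorticity V s y, (Δ (lerayVorticity V s)) y⟫ =
        ⟪(Δ (lerayVorticity V s)) y, lerayVorticity V s y⟫ := real_inner_comm _ _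
    have e2 : ⟪lerayVorticity V s y, fderiv ℝ (lerayVorticity V s) y y⟫ =
        ⟪fderiv ℝ (lerayVorticity V s) y y, lerayVorticity V s y⟫ := real_inner_comm _ _
    have e3 : ⟪lerayVorticity V s y, fderiv ℝ (lerayVorticity V s) y (lerayOrbit V s y)⟫ =
        ⟪convect (lerayOrbit V s) (lerayVorticity V s) y, lerayVorticity V s y⟫ := by
      simp only [convect]; exact real_inner_comm _ _
    simp only [inner_sub_right, inner_add_right, real_inner_smul_right, real_inner_self_eq_norm_sq,
      e1, e2, e3]
    ring
  simp_rw [hpt]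
  rw [integral_add ?_ (iS.const_mul 2), integral_sub ?_ (iT.const_mul 2), integral_sub ?_ iD,
    integral_sub (iL.const_mul 2) (iZ.const_mul 2), integral_const_mul, integral_const_mul,
    integral_const_mul, integral_const_mul, hL, hT]
  · -- arithmetic: `2(−F) − 2Z − (−(3/2)Z) − 0 + 2 Str = 2(−F − ¼Z + Str)`
    have hR' : ∫ y, ⟪fderiv ℝ (lerayVorticity V s) y y, lerayVorticity V s y⟫ =
        -(3 / 2) * ∫ y, ‖lerayVorticity V s y‖ ^ 2 := by linarith
    rw [hR']
    ring
  · exact (iL.const_mul 2).sub (iZ.const_mul 2)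
  · exact ((iL.const_mul 2).sub (iZ.const_mul 2)).sub iD
  · exact (((iL.const_mul 2).sub (iZ.const_mul 2)).sub iD).sub (iT.const_mul 2)

end Summit.NavierStokesRegularity.NavierStokesRegularity.Theorems.SimilarityEnstrophy
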